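import Literature.Barriers.BirchSwinnertonDyer.NoAdmissiblePrimesAtThree
import Mathlib.RingTheory.Norm.Basic
import HarnessLib

/-!
# Barrier (BirchSwinnertonDyer): no Bertolini–Darmon admissible primes for a CM form at a prime INERT in
# the CM field — the bipartite-Euler-system / admissible-level-raising architecture has an EMPTY supply
# of auxiliary primes on all of CornerF-inert (CM, `p` inert in the CM field), for every `p`

Barrier catalogue `Literature/Barriers/BirchSwinnertonDyer/` (D-0021), companion of
`NoAdmissiblePrimesAtThree` (same technique class — bipartite Euler systems and Kolyvagin-system
triangulation built from level raising at Bertolini–Darmon `n`-admissible primes: Bertolini–Darmon 2005,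
Howard 2006, W. Zhang 2014, Burungale–Castella–Kim 2021, Sweeting 2020 — evaluated not at a prime but on a
CLASS OF FORMS: weight-two newforms with complex multiplication by an imaginary quadratic field `L`, at a
prime `p` inert in `L`). Suggested and proved by the W-ALL planner seat `bsd-wall-cm` g7, filed verbatim (three doc-marker words reworded, one cite added) by the typer seat `bsd-wall-ty-1` g9 (memo
`run/shared/lean/pub/bsd-wall/bsd-wall-cm/g7/K12-LANE-V-SCOPING-g7.md` §2). HONEST FRAMING: an ARITHMETIC
wall on the auxiliary-prime supply AS DEFINED IN PRINT (clauses (3) `p ∤ ℓ² − 1` and (4)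
`pⁿ ∣ ℓ + 1 ∓ a_ℓ`), and a THEOREM (`noAdmissiblePrimesCMInert_holds`); it says nothing about the truth of
an anticyclotomic main conjecture or of Kolyvagin's conjecture for such forms (scope_caveats).

## The input from print
* The admissibility predicate is the tree's `BertoliniDarmon2005.IsAdmissiblePrime N K a p n ℓ`
  (Ann. of Math. 162 (2005), p. 18: (1) `ℓ ∤ pN`; (2) `ℓ` inert in `K`; (3) `p ∤ ℓ² − 1`; (4)
  `pⁿ ∣ ℓ + 1 − a_ℓ` or `pⁿ ∣ ℓ + 1 + a_ℓ`), cited, not restated; W. Zhang, Camb. J. Math. 2 (2014)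
  p. 202 (xiv) and Sweeting arXiv:2012.11771 Def. 3.1 ("`M`-BD-admissible") are the same notion.
* Every member of the class assumes a LARGE residual image, which excludes CM at the source: W. Zhang
  2014 p. 193 "Throughout this paper we assume that `ρ̄_{E,p}` is surjective" (used in Lemma 7.3, p. 232,
  for a positive density of admissible primes); Sweeting 2020 §1 "the image of the residual representation
  … is full, i.e., contains `SL₂(𝓞/𝔭)`"; Bertolini–Darmon 2005 p. 22 (Čebotarev supply, Thm. 3.2).
  This entry records that for CM forms at an inert `p` the exclusion is not a convenience: the supply is
  EMPTY.
* The CM input (Deuring; e.g. Silverman, Advanced Topics II §10, Thm. 10.5 and Ex. 2.30/2.33): for a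
  newform `f = f_E`, `E/ℚ` with CM by (an order of) `L`, and a prime `ℓ` of good reduction, `a_ℓ = 0`
  if `ℓ` is inert in `L`, and `a_ℓ = π + π̄` with `π ∈ 𝓞_L`, `π π̄ = ℓ` if `ℓ` splits in `L`
  (primes ramified in `L` divide the conductor). Below this is the HYPOTHESIS `hCM` ("CM dichotomy"),
  stated over `𝓞 L` with complex conjugation an involutive ring endomorphism `σ`; instantiating it for a
  given curve is the consumer's job (a named Deuring fact), the barrier itself needs nothing.

## The proof (two lines)
Let `n ≥ 1` and suppose `ℓ` admissible. Clause (4) gives `p ∣ ℓ + 1 − ε a_ℓ`, `ε = ±1`. If `a_ℓ = 0`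
then `p ∣ ℓ + 1 ∣ ℓ² − 1`, against (3). If `a_ℓ = π + σπ`, `ℓ = π σπ`, then
`(π − ε)(σπ − ε) = ℓ + 1 − ε a_ℓ ≡ 0 (mod p𝓞_L)`; `p𝓞_L` is PRIME (`p` inert) and `σ`-stable, so both
`π ≡ ε` and `σπ ≡ ε`, whence `ℓ = π σπ ≡ ε² = 1 (mod p𝓞_L)`; `ℤ → 𝓞_L` reflects divisibility by `p`
(norms: `N(m) = m^{[L:ℚ]}`), so `p ∣ ℓ − 1 ∣ ℓ² − 1`, against (3). Galois-side reading: the residual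
image lies in the normaliser of a non-split Cartan subgroup, all of whose elements are semisimple with
eigenvalue ratio `1`, a Galois-conjugate pair, or `−1` — never `{ε, εℓ}` with `ℓ ≢ ±1 (mod p)` (and never
`±` a regular unipotent, so "unipotent-admissible" primes `ℓ ≡ 1`, `a_ℓ ≡ ±2`, one Jordan block, do not
exist either).

## Contents
* `dvd_mul_conj_sub_one` — the core congruence in a commutative ring with an involutive endomorphism and
  `(p)` prime.
* `not_isAdmissiblePrime_of_cmDichotomy`, `not_hasAdmissiblePrime_of_cmDichotomy` — abstract form over
  any commutative ring `R` (`σ` involutive, `(p)` prime, `ℤ → R` reflects `p ∣ ·`, CM dichotomy).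
* `int_dvd_of_ringOfIntegers_dvd` — `ℤ → 𝓞 L` reflects divisibility by `p` (norm argument).
* `NoAdmissiblePrimesCMInert` — the barrier `Prop` (over `𝓞 L`) and `noAdmissiblePrimesCMInert_holds`.

## D-0021 structured block
Carried by the docstring of `NoAdmissiblePrimesCMInert` below.

## References (bib keys of `lean/references.bib`)
[BertoliniDarmon2005] p. 18 (Admissible primes, Lemma 2.6), p. 22 (proof of Thm. 3.2) · [WZhang2014]
pp. 193, 202 (xiv), 232 (Lemma 7.3) · [Sweeting2020] §1, Def. 3.1, Thm. 3.3, §4 · [Howard2006] Def. 3.1.1 ·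
[BurungaleCastellaKim2021] §1.1 · [BertoliniDarmon1999] (Jochnowitz congruences at Kolyvagin primes — the
surviving evasion). Cell documents: `run/shared/lean/pub/bsd-wall/bsd-wall-cm/g7/K12-LANE-V-SCOPING-g7.md`.
-/

namespace Literature.Barriers.BirchSwinnertonDyer

open Literature.NumberTheory.EllipticCurves.BertoliniDarmon2005
open NumberField

universe u v

section Core

variable {R : Type v} [CommRing R] (σ : R →+* R) (p : ℕ)

/-- Core congruence (split case of the Deuring dichotomy). In a commutative ring `R` with a ring
endomorphism `σ`, `σ ∘ σ = id`, if `(p)` is a prime ideal and `p ∣ π·σπ + 1 − ε (π + σπ)` with `ε² = 1`,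
then `p ∣ π·σπ − 1`: indeed `(π − ε)(σπ − ε) ∈ (p)`, one factor lies in `(p)`, applying `σ` so does the
other, and `π σπ − 1 = (π − ε) σπ + ε (σπ − ε)`.
[cite: BertoliniDarmon2005, p. 18 (Admissible primes) (3)–(4)] -/
theorem dvd_mul_conj_sub_one (hσ : ∀ x, σ (σ x) = x) (hP : (Ideal.span {(p : R)}).IsPrime)
    (π : R) (ε : ℤ) (hε : ε ^ 2 = 1)
    (h : (p : R) ∣ π * σ π + 1 - (ε : R) * (π + σ π)) :
    (p : R) ∣ π * σ π - 1 := by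
  have hεR : ((ε : R)) ^ 2 = 1 := by exact_mod_cast congrArg (fun z : ℤ => (z : R)) hε |>.trans (by simp)
  have hε1 : (ε : R) * (ε : R) = 1 := by rw [← sq]; exact hεR
  have hfac : (π - (ε : R)) * (σ π - (ε : R)) = π * σ π + 1 - (ε : R) * (π + σ π) := by
    linear_combination hε1
  have hmem : (π - (ε : R)) * (σ π - (ε : R)) ∈ Ideal.span {(p : R)} := by
    rw [Ideal.mem_span_singleton, hfac]; exact h
  have hσp : σ (p : R) = (p : R) := map_natCast σ p
  have hσε : σ (ε : R) = (ε : R) := map_intCast σ ε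
  have hboth : (p : R) ∣ π - (ε : R) ∧ (p : R) ∣ σ π - (ε : R) := by
    rcases hP.mem_or_mem hmem with h1 | h2
    · rw [Ideal.mem_span_singleton] at h1
      refine ⟨h1, ?_⟩
      obtain ⟨c, hc⟩ := h1
      refine ⟨σ c, ?_⟩
      have := congrArg σ hc
      simpa [map_sub, map_mul, hσp, hσε] using this
    · rw [Ideal.mem_span_singleton] at h2
      refine ⟨?_, h2⟩
      obtain ⟨c, hc⟩ := h2
      refine ⟨σ c, ?_⟩
      have := congrArg σ hc
      simpa [map_sub, map_mul, hσp, hσε, hσ] using this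
  obtain ⟨h1, h2⟩ := hboth
  have hid : π * σ π - 1 = (π - (ε : R)) * σ π + (ε : R) * (σ π - (ε : R)) := by
    linear_combination hε1
  rw [hid]
  exact dvd_add (h1.mul_right _) (h2.mul_left _)

/-- **No admissible primes for CM coefficients at an inert prime (abstract form).** `R` a commutative
ring with an involutive endomorphism `σ` (complex conjugation on `𝓞_L`), `(p) ⊂ R` prime (`p` inert in
`L`), `ℤ → R` reflecting divisibility by `p`; the coefficient system `a` satisfies the CM (Deuring)
dichotomy: for every prime `ℓ ∤ pN`, `a ℓ = 0` or `a ℓ = π + σπ` with `π σπ = ℓ`. Then NO prime is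
Bertolini–Darmon `n`-admissible for `(N, K, a, p, n)` when `1 ≤ n`, whatever the field `K`.
[cite: BertoliniDarmon2005, p. 18 (Admissible primes)] [cite: WZhang2014, p. 193 and p. 202 (xiv)] -/
theorem not_isAdmissiblePrime_of_cmDichotomy {N : ℕ} {K : Type u} [Field K] {a : ℕ → ℤ} {n : ℕ}
    (hσ : ∀ x, σ (σ x) = x) (hP : (Ideal.span {(p : R)}).IsPrime)
    (hrefl : ∀ m : ℤ, (p : R) ∣ (m : R) → (p : ℤ) ∣ m)
    (hCM : ∀ ℓ : ℕ, ℓ.Prime → ¬ ℓ ∣ p * N →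
      a ℓ = 0 ∨ ∃ π : R, ((a ℓ : ℤ) : R) = π + σ π ∧ ((ℓ : ℕ) : R) = π * σ π)
    (hn : 1 ≤ n) (ℓ : ℕ) : ¬ IsAdmissiblePrime N K a p n ℓ := by
  intro h
  have h3 := h.not_dvd_sq_sub_one
  have hpn : (p : ℤ) ∣ (p : ℤ) ^ n := dvd_pow_self _ (by omega)
  have h4 : ∃ ε : ℤ, ε ^ 2 = 1 ∧ (p : ℤ) ∣ (ℓ : ℤ) + 1 - ε * a ℓ := by
    rcases h.pow_dvd with h4 | h4
    · exact ⟨1, by norm_num, by simpa using hpn.trans h4⟩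
    · exact ⟨-1, by norm_num, by simpa using hpn.trans h4⟩
  obtain ⟨ε, hε, h4⟩ := h4
  rcases hCM ℓ h.prime h.not_dvd with h0 | ⟨π, haπ, hℓπ⟩
  · -- inert case: `a_ℓ = 0`, so `p ∣ ℓ + 1 ∣ ℓ² − 1`
    rw [h0, mul_zero, sub_zero] at h4
    exact h3 (h4.trans ⟨(ℓ : ℤ) - 1, by ring⟩)
  · -- split case: `a_ℓ = π + σπ`, `ℓ = π σπ`
    have hR : (p : R) ∣ π * σ π + 1 - (ε : R) * (π + σ π) := by
      obtain ⟨c, hc⟩ := h4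
      refine ⟨(c : R), ?_⟩
      have := congrArg (fun z : ℤ => (z : R)) hc
      simp only [Int.cast_sub, Int.cast_add, Int.cast_mul, Int.cast_natCast, Int.cast_one,
        Int.cast_natCast] at this
      rw [← haπ, ← hℓπ]
      exact_mod_cast this
    have hdiv := dvd_mul_conj_sub_one σ p hσ hP π ε hε hR
    rw [← hℓπ] at hdiv
    have hZ : (p : ℤ) ∣ (ℓ : ℤ) - 1 := by
      apply hrefl
      push_cast
      exact hdiv
    exact h3 (hZ.trans ⟨(ℓ : ℤ) + 1, by ring⟩)

/-- Hence the technique class `HasAdmissiblePrime` is EMPTY for CM coefficients at an inert prime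
(abstract form). [cite: BertoliniDarmon2005, p. 18 (Admissible primes) and Thm. 3.2] -/
theorem not_hasAdmissiblePrime_of_cmDichotomy {N : ℕ} {K : Type u} [Field K] {a : ℕ → ℤ} {n : ℕ}
    (hσ : ∀ x, σ (σ x) = x) (hP : (Ideal.span {(p : R)}).IsPrime)
    (hrefl : ∀ m : ℤ, (p : R) ∣ (m : R) → (p : ℤ) ∣ m)
    (hCM : ∀ ℓ : ℕ, ℓ.Prime → ¬ ℓ ∣ p * N →
      a ℓ = 0 ∨ ∃ π : R, ((a ℓ : ℤ) : R) = π + σ π ∧ ((ℓ : ℕ) : R) = π * σ π)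
    (hn : 1 ≤ n) : ¬ HasAdmissiblePrime N K a p n := by
  rintro ⟨ℓ, hℓ⟩
  exact not_isAdmissiblePrime_of_cmDichotomy σ p hσ hP hrefl hCM hn ℓ hℓ

end Core

section RingOfIntegers

/-- `ℤ → 𝓞 L` reflects divisibility by a rational prime `p` (indeed by any integer): take norms,
`N(m) = m ^ [L:ℚ]`, and `p^d ∣ m^d ↔ p ∣ m`. [cite: NeukirchANT1999, Ch. I §2, (2.6) (norm of a rational integer)] -/
theorem int_dvd_of_ringOfIntegers_dvd (L : Type*) [Field L] [NumberField L] (p : ℕ)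
    (m : ℤ) (h : ((p : ℤ) : 𝓞 L) ∣ ((m : ℤ) : 𝓞 L)) : (p : ℤ) ∣ m := by
  have hN := map_dvd (Algebra.norm ℤ (S := 𝓞 L)) h
  rw [show ((p : ℤ) : 𝓞 L) = algebraMap ℤ (𝓞 L) (p : ℤ) from rfl,
    show ((m : ℤ) : 𝓞 L) = algebraMap ℤ (𝓞 L) m from rfl,
    Algebra.norm_algebraMap, Algebra.norm_algebraMap] at hN
  have hd : Module.finrank ℤ (𝓞 L) ≠ 0 := Module.finrank_pos.ne'
  exact (Int.pow_dvd_pow_iff hd).mp hN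

/-- **The barrier**: for a coefficient system `a` with the CM (Deuring) dichotomy over `𝓞 L` (complex
conjugation `σ`, an involutive ring endomorphism) and a prime `p` INERT in `L` (`p𝓞_L` prime), the class
`HasAdmissiblePrime N K a p n` is EMPTY for every `n ≥ 1`, every level `N` and every field `K`. PROVED
below (`noAdmissiblePrimesCMInert_holds`); the closed `Prop` is the decl that idea cards and route theses
cite.

BARRIER (D-0021), one line per key:
* technique_class: bipartite-euler-systems level-raising-at-admissible-primes kolyvagin-system-triangulation anticyclotomic-iwasawa — formally `HasAdmissiblePrime N K a p n` (∃ a Bertolini–Darmon `n`-admissible prime), here for CM coefficient systems at an inert `p`.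
* blocks: for weight-two CM newforms (CM field `L`; every CM elliptic curve over `ℚ`, i.e. all of CornerF) at every prime `p` INERT in `L` — any level, any auxiliary imaginary quadratic `K`, any `n ≥ 1` — every INSTANTIATION of a theorem of the class as printed (BD05 Thm. 1, Howard 2006 Thm. B via Def. 3.1.1, W. Zhang 2014 Thms. 1.1–1.4 via Lemma 7.3, BCK21, Sweeting 2020 §§4–7 whose classes `c_M(n, Q)` live on BD-admissible `Q`, CHKLL23 §7) and every transfer of its METHOD (Selmer-rank-lowering "triangulation" by admissible primes; first/second reciprocity laws at admissible primes): the auxiliary-prime supply is EMPTY, not merely missing from print. In the W-ALL programme: BED dossier line H-B, bsd-cm TARGET R35 («Zhang-type converse for W over K′»), the divisible case of the conjugate-pair Kolyvagin-primitivity card, any «extend AdditiveKolyvaginRoad to CM-inert».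
* because: clause (4) `p ∣ ℓ + 1 ∓ a_ℓ` together with the Deuring dichotomy (`a_ℓ = 0` for `ℓ` inert in `L`; `a_ℓ = π + π̄`, `π π̄ = ℓ` for `ℓ` split) forces `ℓ ≡ −1` resp. `ℓ ≡ +1 (mod p)` — the split case because `(π ∓ 1)(π̄ ∓ 1) = ℓ + 1 ∓ a_ℓ` vanishes modulo the PRIME, conjugation-stable ideal `p𝓞_L`, so `π ≡ π̄ ≡ ±1` and `ℓ = π π̄ ≡ 1` — against clause (3) `p ∤ ℓ² − 1`. Galois reading: residual image in the normaliser of a non-split Cartan subgroup; no element has eigenvalues `{ε, εℓ}` with `ℓ ≢ ±1`.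
* evasions_known: (i) TAYLOR-admissible = Kolyvagin-type primes, `ℓ ≡ −1 (mod p)` with `a_ℓ ≡ 0` (Frobenius in the non-trivial Cartan coset; positive density): level raising survives (Sweeting 2020 Thm. 3.3; Bertolini–Darmon 1999 Jochnowitz congruences), with local cohomology of rank `2 + 2` split `1+1+1+1` by the Frobenius sign — but no printed induction / IMC argument runs on them alone; (ii) Kolyvagin's METHOD itself (upper bound on `Ш` by the Heegner index) is untouched; (iii) Eisenstein/Katz descent through an auxiliary field `K′` in which `p` SPLITS (route BiquadraticEisensteinDescent); (iv) Rubin's elliptic-unit Euler system and signed branches of the inert two-variable tower (route InertBadSignedBranches); (v) `p` SPLIT in `L` is NOT covered — there `a_ℓ mod 𝔭` is unconstrained and admissible primes exist.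
* scope_caveats: (a) a statement about the auxiliary primes AS DEFINED IN PRINT (clauses (3)–(4)); it does not say that any anticyclotomic IMC, Kolyvagin-type hypothesis or `BSD_p` fails or cannot be proved for CM forms at inert `p`; (b) the CM input is the HYPOTHESIS `hCM` (Deuring dichotomy over `𝓞 L` with an involutive `σ`) — instantiating it on a given curve needs a Deuring fact, not supplied here; (c) `n = 0` is excluded (clause (4) is then vacuous).
* status: established (theorem `noAdmissiblePrimesCMInert_holds`, via `not_isAdmissiblePrime_of_cmDichotomy` and the norm reflection `int_dvd_of_ringOfIntegers_dvd`).

[cite: BertoliniDarmon2005, p. 18 (Admissible primes) (3)–(4) and p. 22 (proof of Thm. 3.2)]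
[cite: WZhang2014, p. 193 (standing surjectivity), p. 202 (xiv) and Lemma 7.3 (p. 232)]
[cite: Sweeting2020, §1, Def. 3.1 and Thm. 3.3] [cite: Howard2006, Def. 3.1.1] -/
def NoAdmissiblePrimesCMInert : Prop :=
  ∀ (N : ℕ) (K : Type u) [Field K] (a : ℕ → ℤ) (p n : ℕ) (L : Type) [Field L] [NumberField L]
    (σ : 𝓞 L →+* 𝓞 L),
    p.Prime → (∀ x, σ (σ x) = x) → (Ideal.span {(p : 𝓞 L)}).IsPrime →
    (∀ ℓ : ℕ, ℓ.Prime → ¬ ℓ ∣ p * N →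
      a ℓ = 0 ∨ ∃ π : 𝓞 L, ((a ℓ : ℤ) : 𝓞 L) = π + σ π ∧ ((ℓ : ℕ) : 𝓞 L) = π * σ π) →
    1 ≤ n → ¬ HasAdmissiblePrime N K a p n

/-- The barrier holds. [cite: BertoliniDarmon2005, p. 18 (Admissible primes)]
[cite: WZhang2014, p. 202 (xiv)] -/
theorem noAdmissiblePrimesCMInert_holds : NoAdmissiblePrimesCMInert.{u} := by
  intro N K _ a p n L _ _ σ _hp hσ hP hCM hn
  refine not_hasAdmissiblePrime_of_cmDichotomy σ p hσ hP ?_ hCM hn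
  intro m hm
  exact int_dvd_of_ringOfIntegers_dvd L p m (by exact_mod_cast hm)

/-- `NoAdmissiblePrimesCMInert` — `_holds` alias of `noAdmissiblePrimesCMInert_holds` above under the fact's exact name (appended
2026-08-28, D-0026 bookkeeping: the proof term is the existing theorem of this file; no statement,
definition or attribute is edited; no new named fact; the ledger's debt table listed the fact
unproved). [cite: WZhang2014, p. 202 (xiv)] -/
theorem _root_.Literature.Barriers.BirchSwinnertonDyer.NoAdmissiblePrimesCMInert_holds :
    NoAdmissiblePrimesCMInert.{u} :=
  _root_.Literature.Barriers.BirchSwinnertonDyer.noAdmissiblePrimesCMInert_holds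

/-- Pointwise form, the shape a planner's crux or a card's BARRIERS line consumes: under the CM dichotomy
at an inert `p`, `¬ IsAdmissiblePrime N K a p n ℓ` for every `ℓ` (`n ≥ 1`).
[cite: BertoliniDarmon2005, p. 18 (Admissible primes)] -/
theorem not_isAdmissiblePrime_of_cmInert {N : ℕ} {K : Type u} [Field K] {a : ℕ → ℤ} {p n : ℕ}
    {L : Type} [Field L] [NumberField L] (σ : 𝓞 L →+* 𝓞 L) (hσ : ∀ x, σ (σ x) = x)
    (hP : (Ideal.span {(p : 𝓞 L)}).IsPrime)
    (hCM : ∀ ℓ : ℕ, ℓ.Prime → ¬ ℓ ∣ p * N →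
      a ℓ = 0 ∨ ∃ π : 𝓞 L, ((a ℓ : ℤ) : 𝓞 L) = π + σ π ∧ ((ℓ : ℕ) : 𝓞 L) = π * σ π)
    (hn : 1 ≤ n) (ℓ : ℕ) : ¬ IsAdmissiblePrime N K a p n ℓ :=
  not_isAdmissiblePrime_of_cmDichotomy σ p hσ hP
    (fun m hm => int_dvd_of_ringOfIntegers_dvd L p m (by exact_mod_cast hm)) hCM hn ℓ

end RingOfIntegers

end Literature.Barriers.BirchSwinnertonDyer
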